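import Literature.Probability.RandomPlanarGeometry.YangBaxterSAWGeneralDomain
import HarnessLib

/-!
# Barrier catalogue (SAWScalingLimit), positive side: C-B2 with the catalogue's root quantifier on
face lists WITHOUT HOLES, and the decidable sufficient condition ROW-CONVEX

Companion of `Literature.Probability.RandomPlanarGeometry.YangBaxterSAWGeneralDomain` (Glazman–
Manolescu's Lemma 2.1 on a general finite face domain for a general OUTER root, and its statement in
the `PlaquetteWalk` vocabulary `PlaquetteWalkYBIdentityOuter_holds`) and of the necessity files
`PlaquetteWalkSpinRigidity`, `PlaquetteWalkWeightRigidityPrinted`, `PlaquetteWalkNoTouch`,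
`PlaquetteWalkSignGauge`. Content:

* `NoHoles Dl` (combinatorial: every exterior face is joined to beyond the list by a king-chain of
  exterior faces) and `outerRoot_of_noHoles`: for face lists without holes the catalogue's
  `IsBoundaryRoot` already gives an outer root, hence `vertexFunctional_printed_eq_zero_of_noHoles`
  — C-B2 exactly as worded in the lane («every simply connected face-list domain, every boundary
  root»), named `PlaquetteWalkYBIdentity` / `PlaquetteWalkYBIdentity_holds`;
* a worked non-convex example (`bay_example`: the U-shaped domain rooted in its bay — an outer root
  that is not a supporting-line root);
* `RowConvex Dl` (decidable) and `noHoles_of_rowConvex`, `vertexFunctional_printed_eq_zero_of_rowConvex`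
  (rectangles, L/T/plus shapes, staircases — in particular every instance domain of the necessity
  files), with the lane's L-shaped table domain as a `decide`d example.

Sources and scope as printed: A. Glazman, I. Manolescu, arXiv:1708.00395, Lemma 2.1
[cite: GlazmanManolescu2019, Lemma 2.1] is printed for the rectangles `Rect_{T,L}` (row-convex,
hole-free). H. Duminil-Copin, S. Smirnov, Ann. Math. 175 (2012) state their hexagonal-lattice Lemma 1
for every vertex `v ∈ V(Ω)` of a SIMPLY CONNECTED domain `Ω` («We further assume Ω to be simply
connected, i.e. having a connected complement», arXiv:1007.0575 §2, the paragraph defining domains)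
with the root `a ∈ ∂Ω`, and use exactly this at the loop-winding step of the proof («we used the fact
that a is on the boundary and Ω is simply connected») [cite: DuminilCopinSmirnov2012, §2 (domains)
and Lemma 1 with its proof]. `NoHoles` / `RowConvex` below are square-lattice face-list forms of that
printed hypothesis (connected complement = the exterior faces king-connected to infinity); the head
file's `OuterRoot` theorem extends it to outer roots of domains WITH holes; for roots on the boundary
of a hole the identity fails (venture lane «pcv-sawmu», HOME/STRUCTURE.md C-I item 1: 124/1192
nonzero rows, all hole-rooted) — consistent with, not an exception to, the printed hypothesis. Not
here: the two-sided classification with one technique class (`PlaquetteWalkYBClassification`).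

Written for the venture lane «pcv-sawmu» (Tier B; HOME/STRUCTURE.md §2 C-B2; b-engine-1 gen 9/10).
-/

noncomputable section

namespace Literature.Barriers.CriticalPhenomena.PlaquetteWalk

open Literature.Probability.RandomPlanarGeometry.SAW.YangBaxter Real Complex
/-! ### Domains without holes: every boundary root is outer -/

/-- **A face list without holes** (combinatorially): every face outside the domain is joined to
beyond the domain by a king-chain of exterior faces — the complement is king-connected to
infinity (Duminil-Copin–Smirnov's «simply connected, i.e. having a connected complement»). For such
domains the outer-root hypothesis reduces to the catalogue's `IsBoundaryRoot`.
[cite: DuminilCopinSmirnov2012, §2 (domains: simply connected, i.e. having a connected complement) and Lemma 1] -/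
def NoHoles (Dl : List Face) : Prop :=
  ∀ g₀ : Face, g₀ ∉ Dl → ∃ (n : ℕ) (g : ℕ → Face), g 0 = g₀ ∧ (∀ i ≤ n, g i ∉ Dl) ∧
    (∀ i < n, ∃ q : ℤ × ℤ, IsCornerOf q (g i) ∧ IsCornerOf q (g (i + 1))) ∧
    ((∀ f ∈ Dl, (g n).1 < f.1) ∨ (∀ f ∈ Dl, f.1 < (g n).1) ∨ (∀ f ∈ Dl, (g n).2 < f.2) ∨ (∀ f ∈ Dl, f.2 < (g n).2))

/-- **In a domain without holes every boundary root is an outer root.**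
[cite: DuminilCopinSmirnov2012, §2 and Lemma 1 (Ω simply connected, a ∈ ∂Ω)] -/
theorem outerRoot_of_noHoles {Dl : List Face} (hD : NoHoles Dl) {a : MidEdge} (ha : IsBoundaryRoot Dl a) :
    OuterRoot (dom Dl) a := by
  -- the face of `a` outside the domain, with `a` as one of its sides
  obtain ⟨g₀, hg₀, s, hs⟩ : ∃ g₀ : Face, g₀ ∉ Dl ∧ ∃ s : Side, g₀.side s = a := by
    rcases ha with ⟨-, h2⟩ | ⟨h1, -⟩
    · exact ⟨a.faces.2, h2, (Face.exists_side_eq_iff a.faces.2 a).2 (Or.inr rfl)⟩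
    · exact ⟨a.faces.1, h1, (Face.exists_side_eq_iff a.faces.1 a).2 (Or.inl rfl)⟩
  obtain ⟨n, g, hg0, hD', hlink, hbey⟩ := hD g₀ hg₀
  refine ⟨n, g, ⟨s, by rw [hg0, hs]⟩, fun i hi => hD' i hi, hlink, ?_⟩
  simpa [dom] using hbey

/-- **C-B2 as worded in the lane's STRUCTURE.md** («every simply connected face-list domain, every
boundary root»): for a face list without holes the catalogue's root quantifier suffices.
[cite: GlazmanManolescu2019, Lemma 2.1] -/
theorem vertexFunctional_printed_eq_zero_of_noHoles {θ : ℝ} (hθ : θ ∈ Set.Icc (π / 3) (2 * π / 3))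
    {Dl : List Face} (hD : NoHoles Dl) {a : MidEdge} (ha : IsBoundaryRoot Dl a) (f₀ : Face) (hf : f₀ ∈ Dl) :
    vertexFunctional (printedWeights θ) tFiveEighths (ybCoeff θ) Dl a f₀ = 0 :=
  vertexFunctional_printed_eq_zero hθ Dl a (outerRoot_of_noHoles hD ha) f₀ hf

/-- **C-B2 (lane «pcv-sawmu», STRUCTURE.md §2) as worded — every face-list domain without holes, every
boundary root**: for every `θ ∈ [π/3, 2π/3]`, every finite face list `Dl` with `NoHoles Dl`, every
root `a` with `IsBoundaryRoot Dl a` and every face `f₀ ∈ Dl`,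
`vertexFunctional (printedWeights θ) tFiveEighths (1, r(θ), −1, −r(θ)) Dl a f₀ = 0`.
[cite: GlazmanManolescu2019, Lemma 2.1] -/
def _root_.Literature.Barriers.CriticalPhenomena.PlaquetteWalkYBIdentity : Prop :=
  ∀ θ : ℝ, θ ∈ Set.Icc (π / 3) (2 * π / 3) → ∀ (Dl : List Face), NoHoles Dl → ∀ (a : MidEdge) (f₀ : Face),
    f₀ ∈ Dl → IsBoundaryRoot Dl a → vertexFunctional (printedWeights θ) tFiveEighths (ybCoeff θ) Dl a f₀ = 0

/-- **C-B2 as worded holds.** [cite: GlazmanManolescu2019, Lemma 2.1] -/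
theorem _root_.Literature.Barriers.CriticalPhenomena.PlaquetteWalkYBIdentity_holds : PlaquetteWalkYBIdentity :=
  fun _ hθ _ hD a f₀ hf ha => vertexFunctional_printed_eq_zero_of_noHoles hθ hD (a := a) ha f₀ hf

/-! ### A worked non-convex example: a root in the bay of a U-shaped domain -/

/-- The U-shaped domain `{(0,0), (2,0), (0,1), (1,1), (2,1)}` (legs `(0,0)`, `(2,0)`, top row
`(0,1), (1,1), (2,1)`; the bay `(1,0)` is outside) and the root `slant 1 1` = the top side of the
bay: NOT a supporting-line root, but an OUTER root through the chain `(1,0) → (1,−1)` (sharing the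
corner `(1,0)`), the face `(1,−1)` lying below the whole domain. [folklore] -/
private theorem outerRoot_bay_example :
    OuterRoot (dom [((0 : ℤ), (0 : ℤ)), (2, 0), (0, 1), (1, 1), (2, 1)]) (.slant 1 1) := by
  refine ⟨1, fun i => if i = 0 then ((1 : ℤ), (0 : ℤ)) else ((1 : ℤ), (-1 : ℤ)), ⟨.N, rfl⟩, ?_, ?_, ?_⟩
  · intro i hi
    rcases Nat.le_one_iff_eq_zero_or_eq_one.1 hi with rfl | rfl <;> simp [dom]
  · intro i hi
    obtain rfl : i = 0 := by omega
    exact ⟨((1 : ℤ), (0 : ℤ)), by simp [IsCornerOf], by simp [IsCornerOf]⟩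
  · right; right; left
    intro f hf
    simp only [dom, Set.mem_setOf_eq, List.mem_cons, List.not_mem_nil, or_false] at hf
    simp only [if_neg (show (1 : ℕ) ≠ 0 from one_ne_zero)]
    rcases hf with rfl | rfl | rfl | rfl | rfl <;> decide

/-- **The identity in the bay**: at every face of the U-shaped domain, for the bay root, e.g. at
the face `(1, 1)` above the bay. [cite: GlazmanManolescu2019, Lemma 2.1] -/
theorem bay_example {θ : ℝ} (hθ : θ ∈ Set.Icc (π / 3) (2 * π / 3)) :
    vertexFunctional (printedWeights θ) tFiveEighths (ybCoeff θ) [((0 : ℤ), (0 : ℤ)), (2, 0), (0, 1), (1, 1), (2, 1)]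
      (.slant 1 1) (1, 1) = 0 :=
  vertexFunctional_printed_eq_zero hθ _ _ outerRoot_bay_example _ (by simp)


/-! ### Row-convex face lists have no holes (a decidable sufficient condition for `NoHoles`) -/

/-- **Row convexity** (successor-closed form, decidable on concrete lists): between two faces of the
list in the same row, every face belongs to the list. Rectangles, L-, T-, U-turned-sideways- and
staircase-shaped lists are row-convex. [cite: GlazmanManolescu2019, §2.1 (the rectangles Rect_{T,L})] -/
def RowConvex (Dl : List Face) : Prop :=
  ∀ f ∈ Dl, ∀ g ∈ Dl, f.2 = g.2 → f.1 < g.1 → (f.1 + 1, f.2) ∈ Dl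

/-- Row convexity is decidable. [folklore] -/
instance (Dl : List Face) : Decidable (RowConvex Dl) := by unfold RowConvex; infer_instance

/-- The whole row segment between two faces of a row-convex list belongs to it. [folklore] -/
private theorem mem_of_rowConvex {Dl : List Face} (h : RowConvex Dl) {f g : Face} (hf : f ∈ Dl) (hg : g ∈ Dl)
    (hy : f.2 = g.2) : ∀ k : ℕ, f.1 + k ≤ g.1 → (f.1 + k, f.2) ∈ Dl := by
  intro k
  induction k with
  | zero => intro _; simpa using hf
  | succ k ih =>
    intro hk
    have hk' : f.1 + k ≤ g.1 := by push_cast at hk; omega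
    have hmem := ih hk'
    have := h _ hmem g hg (by simpa using hy) (by push_cast at hk; simp; omega)
    simpa [add_assoc] using this

/-- A lower bound of a list of integers by `foldr min`. [folklore] -/
private theorem foldr_min_le (l : List ℤ) (b : ℤ) : (∀ x ∈ l, l.foldr min b ≤ x) ∧ l.foldr min b ≤ b := by
  induction l with
  | nil => simp
  | cons y l ih =>
    refine ⟨fun x hx => ?_, ?_⟩
    · rcases List.mem_cons.1 hx with rfl | hx
      · exact min_le_left _ _
      · exact (min_le_right _ _).trans (ih.1 x hx)
    · exact (min_le_right _ _).trans ih.2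

/-- An upper bound of a list of integers by `foldr max`. [folklore] -/
private theorem le_foldr_max (l : List ℤ) (b : ℤ) : (∀ x ∈ l, x ≤ l.foldr max b) ∧ b ≤ l.foldr max b := by
  induction l with
  | nil => simp
  | cons y l ih =>
    refine ⟨fun x hx => ?_, ?_⟩
    · rcases List.mem_cons.1 hx with rfl | hx
      · exact le_max_left _ _
      · exact (ih.1 x hx).trans (le_max_right _ _)
    · exact ih.2.trans (le_max_right _ _)

/-- **Row-convex face lists have no holes**: from an exterior face walk along its row, away from the
list's faces in that row, to beyond the list. [cite: GlazmanManolescu2019, §2.1 (rectangular domains Rect_{T,L}: no holes)] -/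
theorem noHoles_of_rowConvex {Dl : List Face} (h : RowConvex Dl) : NoHoles Dl := by
  intro g₀ hg₀
  obtain ⟨hm, hm0⟩ := foldr_min_le (Dl.map Prod.fst) g₀.1
  obtain ⟨hM, hM0⟩ := le_foldr_max (Dl.map Prod.fst) g₀.1
  set m := (Dl.map Prod.fst).foldr min g₀.1 with hm_def
  set M := (Dl.map Prod.fst).foldr max g₀.1 with hM_def
  have hmf : ∀ f ∈ Dl, m ≤ f.1 := fun f hf => hm f.1 (List.mem_map.2 ⟨f, hf, rfl⟩)
  have hMf : ∀ f ∈ Dl, f.1 ≤ M := fun f hf => hM f.1 (List.mem_map.2 ⟨f, hf, rfl⟩)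
  by_cases hL : ∃ f ∈ Dl, f.2 = g₀.2 ∧ f.1 ≤ g₀.1
  · -- a face of the list lies weakly left of `g₀` in its row: then none lies weakly right; walk right
    have hR : ∀ g ∈ Dl, g.2 = g₀.2 → g.1 < g₀.1 := by
      intro g hg hgy
      by_contra hge
      obtain ⟨f, hf, hfy, hfx⟩ := hL
      have key := mem_of_rowConvex h hf hg (hfy.trans hgy.symm) (g₀.1 - f.1).toNat
        (by rw [Int.toNat_of_nonneg (by omega)]; omega)
      rw [Int.toNat_of_nonneg (by omega), add_sub_cancel, hfy] at key
      exact hg₀ (by simpa using key)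
    refine ⟨(M + 1 - g₀.1).toNat, fun i => (g₀.1 + i, g₀.2), by simp, fun i _ hmem => ?_, fun i _ => ?_, ?_⟩
    · have := hR _ hmem rfl; simp at this; omega
    · exact ⟨(g₀.1 + i + 1, g₀.2), ⟨Or.inr rfl, Or.inl rfl⟩, ⟨Or.inl (by push_cast; ring), Or.inl rfl⟩⟩
    · right; left
      intro f hf
      have := hMf f hf
      show f.1 < g₀.1 + ((M + 1 - g₀.1).toNat : ℕ)
      rw [Int.toNat_of_nonneg (by omega)]; omega
  · -- no face weakly left of `g₀` in its row: walk left
    refine ⟨(g₀.1 + 1 - m).toNat, fun i => (g₀.1 - i, g₀.2), by simp, fun i _ hmem => ?_, fun i _ => ?_, ?_⟩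
    · exact hL ⟨_, hmem, rfl, by simp⟩
    · exact ⟨(g₀.1 - i, g₀.2), ⟨Or.inl rfl, Or.inl rfl⟩, ⟨Or.inr (by push_cast; ring), Or.inl rfl⟩⟩
    · left
      intro f hf
      have := hmf f hf
      show g₀.1 - ((g₀.1 + 1 - m).toNat : ℕ) < f.1
      rw [Int.toNat_of_nonneg (by omega)]; omega

/-- **C-B2 for row-convex face lists with the catalogue's root quantifier** (rectangles, L/T/plus
shapes, staircases): `IsBoundaryRoot Dl a` suffices. [cite: GlazmanManolescu2019, Lemma 2.1] -/
theorem vertexFunctional_printed_eq_zero_of_rowConvex {θ : ℝ} (hθ : θ ∈ Set.Icc (π / 3) (2 * π / 3))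
    {Dl : List Face} (hD : RowConvex Dl) {a : MidEdge} (ha : IsBoundaryRoot Dl a) (f₀ : Face) (hf : f₀ ∈ Dl) :
    vertexFunctional (printedWeights θ) tFiveEighths (ybCoeff θ) Dl a f₀ = 0 :=
  vertexFunctional_printed_eq_zero_of_noHoles hθ (noHoles_of_rowConvex hD) ha f₀ hf

/-- Example: the L-shaped list `Rect 4×3 ∖ (2×1 corner)` of the lane's tables is row-convex (by
`decide`), so the identity holds there for every boundary root, e.g. at the inner corner face.
[cite: GlazmanManolescu2019, Lemma 2.1] -/
example {θ : ℝ} (hθ : θ ∈ Set.Icc (π / 3) (2 * π / 3)) :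
    vertexFunctional (printedWeights θ) tFiveEighths (ybCoeff θ)
      [((0 : ℤ), (0 : ℤ)), (1, 0), (2, 0), (3, 0), (0, 1), (1, 1), (2, 1), (3, 1), (0, 2), (1, 2)] (.slant 2 2) (1, 1) = 0 :=
  vertexFunctional_printed_eq_zero_of_rowConvex hθ (by decide) (by decide) _ (by simp)

end Literature.Barriers.CriticalPhenomena.PlaquetteWalk
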